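import Literature.NumberTheory.GaloisRepresentations.ArtinConductor
import Literature.NumberTheory.GaloisRepresentations.RamificationFiltrationProofs
import Literature.NumberTheory.GaloisRepresentations.IntegralGaloisActionProofs
import Literature.NumberTheory.GaloisRepresentations.ArtinConductorIntegralityProofs
import Literature.NumberTheory.GaloisRepresentations.GaloisRepFrobeniusProofs
import HarnessLib

/-!
# Discharges of named facts in `ArtinConductor.lean`: unramified ⇒ tame ⇒ conductor `0`
(trunk GalRep, item C10)

D-0014 keeps `Literature/` sorry-free by stating cited results as named facts `def X : Prop`.
This sibling file proves those facts of
`Literature.NumberTheory.GaloisRepresentations.ArtinConductor` that follow from the discharge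
`Literature.NumberTheory.GaloisRepresentations.absUpperRamificationSubgroup_le_inertia_holds` (`Γ_K^v ≤ I_𝔓`, sibling file
`RamificationFiltrationProofs`) through the reduction theorems `X_of` already proved in the parent
file, as `theorem X_holds : X` (users holding `(h : X)` are fed `X_holds`):

* `Literature.NumberTheory.GaloisRepresentations.GaloisRep.IsUnramifiedAtPrime.isTameAt_holds` — a representation unramified at `𝔓`
  (`I_𝔓` acts trivially) is tame at `𝔓` (every `Γ_K^u`, `u > 0`, acts trivially), because
  `Γ_K^u ≤ I_𝔓`;
* `Literature.NumberTheory.GaloisRepresentations.GaloisRep.IsUnramifiedAtPrime.artinConductorAt_eq_zero_holds` — hence `a_𝔓(ρ) = 0`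
  (`codim M^{I_𝔓} = 0` and `sw_𝔓(ρ) = 0`);
* `Literature.NumberTheory.GaloisRepresentations.GaloisRep.artinConductorExponent_eq_zero_of_isUnramifiedAt_holds`,
  `Literature.NumberTheory.GaloisRepresentations.GaloisRep.artinConductorExponent_eq_zero_cofinite_holds`,
  `Literature.NumberTheory.GaloisRepresentations.GaloisRep.artinConductor_eq_top_of_forall_isUnramifiedAt_holds` — the number-field
  packaging (`a_v(ρ) = 0` at unramified `v`; almost all `a_v(ρ) = 0` for `ρ` unramified a.e.;
  `𝔣(ρ) = (1)` for `ρ` unramified everywhere);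
* `Literature.NumberTheory.GaloisRepresentations.WeilDeligneRep.conductor_ofRep_eq_zero_holds` — the Weil–Deligne representation `(ρ, 0)`
  with `ρ` unramified has conductor `0` (from `I_F^u ≤ I_F`,
  `Literature.NumberTheory.GaloisRepresentations.absUpperInertia_le_absInertia_holds`).
* `Literature.NumberTheory.GaloisRepresentations.WeilDeligneRep.upperInertia_zero_holds` — **discharge** of
  `Literature.NumberTheory.GaloisRepresentations.WeilDeligneRep.upperInertia_zero`: `I^0 = I` in the Weil group `W_F` (the parent reduction
  `upperInertia_zero_of` fed with `Literature.absUpperRamificationSubgroup_zero_eq_inertia_holds :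
  Γ_F^0 = I_F` of `RamificationFiltrationProofs`).

Independence of the prime above `v` and the reduction of the specification of the conductor
exponent to integrality
(transport of structure under conjugation; the conjugation lemmas for `I_𝔓` and `Γ_K^u` are in
`RamificationFiltrationProofs`, transitivity of `Γ_K` on the primes above `v` in
`IntegralGaloisActionProofs`):

* `Literature.NumberTheory.GaloisRepresentations.ContinuousRep.codimFixed_conj_smul` — `codim M^{σHσ⁻¹} = codim M^H` (`ρ σ` maps `M^H`
  isomorphically onto `M^{σHσ⁻¹}`);
* `Literature.NumberTheory.GaloisRepresentations.GaloisRep.swanConductorAt_smul`, `Literature.NumberTheory.GaloisRepresentations.GaloisRep.artinConductorAt_smul` —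
  `sw_{σ𝔓}(ρ) = sw_𝔓(ρ)` and `a_{σ𝔓}(ρ) = a_𝔓(ρ)` for every `σ ∈ Γ_K` (any field `K`, any `R`);
* `Literature.NumberTheory.GaloisRepresentations.GaloisRep.artinConductorAt_eq_of_mem_primesAbove_holds` — **discharge** of
  `artinConductorAt_eq_of_mem_primesAbove`: for a number field `K` and two primes `𝔓, 𝔓'` of
  `\bar ℤ_K` above the same finite place `v`, `a_𝔓(ρ) = a_{𝔓'}(ρ)`;
* `Literature.NumberTheory.GaloisRepresentations.GaloisRep.natCast_artinConductorExponent_of_hasOpenInertiaKerAt_of_integrality` —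
  the finite-quotient specification `natCast_artinConductorExponent_of_hasOpenInertiaKerAt`
  (`(a_v(ρ) : ℝ) = a_𝔓(ρ)` at every `𝔓 ∣ v`, for `ρ|_{I_𝔓}` through a finite discrete quotient)
  follows from the finite-quotient Artin–Katz integrality
  `exists_natCast_eq_artinConductorAt_of_hasOpenInertiaKerAt` alone (threaded, D-0014: it rests
  on Herbrand's theorem and the Hasse–Arf/Brauer/Swan-representation theory, none in Mathlib).
  (This replaces the former `natCast_artinConductorExponent_of`, which related the two over-general
  parent defs `exists_natCast_eq_artinConductorAt` / `natCast_artinConductorExponent` — arbitrary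
  topologies on `A`, `M`, and no finite-dimensionality in the former — retired on 2026-08-15 after
  the provefact audits; see the parent file's faithfulness note.)

The corrected specification of the conductor exponent (section
`NumberFieldFiniteQuotientAssembly`):

* `Literature.NumberTheory.GaloisRepresentations.GaloisRep.natCast_artinConductorExponent_of_hasOpenInertiaKerAt_of_herbrand`,
  `Literature.NumberTheory.GaloisRepresentations.GaloisRep.natCast_artinConductorExponent_of_hasOpenInertiaKerAt_of_herbrand_quotient` —
  the parent file's `natCast_artinConductorExponent_of_hasOpenInertiaKerAt` (the specification of
  the conductor exponent with the sources' hypothesis: `ρ|_{I_𝔓}` factors through a finite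
  discrete quotient) from the discharged independence of the prime
  (`artinConductorAt_eq_of_mem_primesAbove_holds`) and the reduction of Artin–Katz integrality
  in `ArtinConductorIntegralityProofs.lean`: it rests on Herbrand's theorem (the named fact
  `absUpperRamificationSubgroup_map_absRestrictNormalHom`, itself reduced there to the finite-level
  `herbrand_quotient` of `RamificationFiltration.lean`) and on Artin's theorem for the inertia
  group (`exists_natCast_eq_artinExponent`) alone.
* `Literature.NumberTheory.GaloisRepresentations.GaloisRep.artinConductorAt_eq_zero_iff_isUnramifiedAt_holds` — **discharge** of
  `artinConductorAt_eq_zero_iff_isUnramifiedAt` (section `UnramifiedIff`): for a number field `K`,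
  `𝔓 ∣ v` and a finite-dimensional `ρ` over a field, `a_𝔓(ρ) = 0 ↔ ρ` is unramified at `v`; the
  parent reduction `artinConductorAt_eq_zero_iff_isUnramifiedAt_of` fed with
  `IsUnramifiedAtPrime.artinConductorAt_eq_zero_holds` and with
  `Literature.NumberTheory.GaloisRepresentations.GaloisRep.isUnramifiedAt_of_isUnramifiedAtPrime_holds` of `GaloisRepFrobeniusProofs`
  (unramified at one `𝔓 ∣ v` ⇒ unramified at `v`), whence the extra import.
* `Literature.NumberTheory.GaloisRepresentations.GaloisRep.HasFiniteWildImageAt.exists_normal_forall_apply_eq_one` — on a Hausdorff `M`, finite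
  wild image forces `ρ` to be trivial on `Gal(K̄/E) ∩ closure (⋃_{u>0} Γ_K^u)` for a finite normal `E/K`
  (Katz's standing hypothesis: `P` acts through a finite discrete quotient), proved.
* `Literature.NumberTheory.GaloisRepresentations.GaloisRep.natCast_artinConductorExponent_lAdic_of_lAdic` — the parent file's `ℓ`-adic
  specification `natCast_artinConductorExponent_lAdic` (continuous `ℓ`-adic `ρ`, `v ∤ ℓ`) from the
  discharged independence of the prime and Katz's `ℓ`-adic integrality
  (`exists_natCast_eq_artinConductorAt_lAdic`, Prop. 1.9 with Remark 1.10) alone.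

Not discharged here: `artinConductorAt_eq_zero_iff_isUnramifiedAt` (its reduction
`artinConductorAt_eq_zero_iff_isUnramifiedAt_of` also consumes the `GaloisRep.lean` fact
`isUnramifiedAt_of_isUnramifiedAtPrime`), and the integrality theorems (Artin, Katz).

## Source

Serre, *Local Fields*, Ch. VI §2: for a finite Galois extension `L/K` with group `G` the Artin
character is induced from the inertia group, `a_G = (a_{G_0})^*` (Prop. 1), and
`f(χ) = Σ_{i ≥ 0} (g_i/g_0)(χ(1) - χ(G_i))` (Cor. 1 to Prop. 2; Cor. 1':
`f(χ) = Σ_i (g_i/g_0) codim V^{G_i}` for the character `χ` of a representation in `V`), which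
vanishes when `G_0` acts trivially; in the upper-numbering form used by the parent file
(`a_𝔓 = codim M^{I_𝔓} + ∫₀^∞ codim M^{Γ_K^u} du`) the vanishing for unramified `ρ` is the
containment `Γ_K^u ≤ Γ_K^0 = I_𝔓` of Ch. IV §3 ("`G^0 = G_0`", and Remark 1 for infinite
extensions), discharged in `RamificationFiltrationProofs`.

Independence of the prime.  Serre (*Local Fields*, Ch. VI §3, "Globalisation") attaches to a
prime `𝔓 ∣ 𝔭` the Artin character `a_𝔓` of the decomposition group `D_𝔓` and notes that
`a_𝔭 = (a_𝔓)^*` for any choice of `𝔓` over `𝔭`; underlying this, the primes above `𝔭` are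
permuted transitively by the Galois group (Neukirch, *Algebraic Number Theory*, Ch. I §9, (9.1))
and every ramification datum of the conjugate prime `σ𝔓` is the conjugate by `σ` of the datum of
`𝔓` (Neukirch, Ch. I §9, after (9.5)).  With the parent file's definition
`a_𝔓(ρ) = codim M^{I_𝔓} + ∫₀^∞ codim M^{Γ_K^u(𝔓)} du`: `I_{σ𝔓} = σ I_𝔓 σ⁻¹`
(`Literature.NumberTheory.GaloisRepresentations.absIntegers.inertia_smul`), `Γ_K^u(σ𝔓) = σ Γ_K^u(𝔓) σ⁻¹`
(`Literature.NumberTheory.GaloisRepresentations.absUpperRamificationSubgroup_smul`), and `v ↦ ρ(σ) v` is an `A`-linear isomorphism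
`M^H ≃ M^{σHσ⁻¹}` inducing `M ⧸ M^H ≃ M ⧸ M^{σHσ⁻¹}`, so the integrands, the Swan conductors and
the Artin conductors at `σ𝔓` and `𝔓` agree.

## References

* J.-P. Serre, *Local Fields*, GTM 67, Springer 1979, Ch. IV §3 (upper numbering, Remark 1);
  Ch. VI §2: Prop. 1, Prop. 2 with Cor. 1 and Cor. 1', Thm 1'. [SerreLocalFields1979]
* J. Tate, *Number theoretic background* (Corvallis 1979), (4.2.4). [TateCorvallis1979]
* J.-P. Serre, *Local Fields*, Ch. VI §3 (globalisation: `a_𝔭 = (a_𝔓)^*` for any `𝔓 ∣ 𝔭`).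
  [SerreLocalFields1979]
* J. Neukirch, *Algebraic Number Theory*, Springer 1999, Ch. I §9, Prop. (9.1) and the remark
  after (9.5). [NeukirchANT1999]
* N. M. Katz, *Gauss Sums, Kloosterman Sums, and Monodromy Groups*, Annals of Math. Studies 116,
  Princeton 1988, Ch. 1, Prop. 1.9 and its proof (p. 19: "the representation of `I` factors
  through a finite quotient `G` of `I`"). [Katz1988]
-/

noncomputable section

open scoped NumberField
open Field IsDedekindDomain

namespace Literature.NumberTheory.GaloisRepresentations

namespace GaloisRep

section General

variable {K : Type*} [Field K] {A : Type*} [CommRing A] [TopologicalSpace A]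
  {M : Type*} [AddCommGroup M] [Module A M] [TopologicalSpace M]

/-- **Discharge of `Literature.NumberTheory.GaloisRepresentations.GaloisRep.IsUnramifiedAtPrime.isTameAt`.**  A representation unramified
at `𝔓` (`I_𝔓` acts trivially) is tame at `𝔓`: every `Γ_K^u`, `u > 0`, acts trivially, since
`Γ_K^u ≤ I_𝔓` (`absUpperRamificationSubgroup_le_inertia_holds`, fed to the parent file's
reduction `IsUnramifiedAtPrime.isTameAt_of`).
Ref: Serre, *Local Fields*, Ch. VI §2 (Prop. 1: `a_G = (a_{G_0})^*`, only inertia enters) and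
Ch. IV §3 (`G^v ⊆ G^0 = G_0`; Remark 1 for infinite extensions).
[cite: SerreLocalFields1979, Ch. VI §2 Prop. 1 and Ch. IV §3 Remark 1] -/
theorem IsUnramifiedAtPrime.isTameAt_holds :
    IsUnramifiedAtPrime.isTameAt (K := K) (A := A) (M := M) :=
  IsUnramifiedAtPrime.isTameAt_of (absUpperRamificationSubgroup_le_inertia_holds (𝓞 K))

/-- **Discharge of `Literature.NumberTheory.GaloisRepresentations.GaloisRep.IsUnramifiedAtPrime.artinConductorAt_eq_zero`.**  A
representation unramified at `𝔓` has Artin conductor `a_𝔓(ρ) = 0` (parent reduction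
`IsUnramifiedAtPrime.artinConductorAt_eq_zero_of` fed with `isTameAt_holds`).
Ref: Serre, *Local Fields*, Ch. VI §2, Thm 1' and Cor. 1' to Prop. 2
(`f(χ) = Σ_i (g_i/g_0) codim V^{G_i}`, which is `0` when `G_0` acts trivially).
[cite: SerreLocalFields1979, Ch. VI §2, Thm 1' and Cor. 1' to Prop. 2] -/
theorem IsUnramifiedAtPrime.artinConductorAt_eq_zero_holds :
    IsUnramifiedAtPrime.artinConductorAt_eq_zero (K := K) (A := A) (M := M) :=
  IsUnramifiedAtPrime.artinConductorAt_eq_zero_of IsUnramifiedAtPrime.isTameAt_holds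

end General

section NumberField

variable {K : Type*} [Field K] [NumberField K] {A : Type*} [CommRing A] [TopologicalSpace A]
  {M : Type*} [AddCommGroup M] [Module A M] [TopologicalSpace M]

/-- **Discharge of `Literature.NumberTheory.GaloisRepresentations.GaloisRep.artinConductorExponent_eq_zero_of_isUnramifiedAt`.**  At an
unramified place the conductor exponent `a_v(ρ)` vanishes (parent reduction
`artinConductorExponent_eq_zero_of_isUnramifiedAt_of`).
Ref: Serre, *Local Fields*, Ch. VI §2, Thm 1' and §3.
[cite: SerreLocalFields1979, Ch. VI §2, Thm 1'] -/
theorem artinConductorExponent_eq_zero_of_isUnramifiedAt_holds :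
    artinConductorExponent_eq_zero_of_isUnramifiedAt (K := K) (A := A) (M := M) :=
  artinConductorExponent_eq_zero_of_isUnramifiedAt_of
    IsUnramifiedAtPrime.artinConductorAt_eq_zero_holds

/-- **Discharge of `Literature.NumberTheory.GaloisRepresentations.GaloisRep.artinConductorExponent_eq_zero_cofinite`.**  For `ρ` unramified
almost everywhere, `a_v(ρ) = 0` for all but finitely many `v` (parent reduction
`artinConductorExponent_eq_zero_cofinite_of`).
Ref: Serre, *Abelian ℓ-adic representations* (1968), Ch. I §2.1; Serre, *Local Fields*,
Ch. VI §3. [cite: SerreAbelianLadic1968, Ch. I §2.1] -/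
theorem artinConductorExponent_eq_zero_cofinite_holds :
    artinConductorExponent_eq_zero_cofinite (K := K) (A := A) (M := M) :=
  artinConductorExponent_eq_zero_cofinite_of artinConductorExponent_eq_zero_of_isUnramifiedAt_holds

/-- **Discharge of `Literature.NumberTheory.GaloisRepresentations.GaloisRep.artinConductor_eq_top_of_forall_isUnramifiedAt`.**  An
everywhere unramified representation has conductor `𝔣(ρ) = (1)` (parent reduction
`artinConductor_eq_top_of_forall_isUnramifiedAt_of`).
Ref: Serre, *Local Fields*, Ch. VI §3. [cite: SerreLocalFields1979, Ch. VI §3] -/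
theorem artinConductor_eq_top_of_forall_isUnramifiedAt_holds :
    artinConductor_eq_top_of_forall_isUnramifiedAt (K := K) (A := A) (M := M) :=
  artinConductor_eq_top_of_forall_isUnramifiedAt_of
    artinConductorExponent_eq_zero_of_isUnramifiedAt_holds

end NumberField

end GaloisRep

namespace WeilDeligneRep

open GaloisRepresentations.IsNonarchimedeanLocalField

variable {F : Type*} [Field F] [ValuativeRel F] [TopologicalSpace F] [IsNonarchimedeanLocalField F]
  {C : Type*} [Field C] [CharZero C] {V : Type*} [AddCommGroup V] [Module C V]

/-- **Discharge of `Literature.NumberTheory.GaloisRepresentations.WeilDeligneRep.conductor_ofRep_eq_zero`.**  For `r = (ρ, 0)` with `ρ`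
an unramified representation of `W_F`, the conductor is `0` (parent reduction
`conductor_ofRep_eq_zero_of` fed with `absUpperInertia_le_absInertia_holds : I_F^u ≤ I_F`).
Ref: Tate, *Number theoretic background* (Corvallis 1979), (4.2.4); Serre, *Local Fields*,
Ch. IV §3. [cite: TateCorvallis1979, (4.2.4)] -/
theorem conductor_ofRep_eq_zero_holds : conductor_ofRep_eq_zero (F := F) (C := C) (V := V) :=
  conductor_ofRep_eq_zero_of (absUpperInertia_le_absInertia_holds F)

variable (F) in
/-- **Discharge of `Literature.NumberTheory.GaloisRepresentations.WeilDeligneRep.upperInertia_zero`.**  `I^0 = I` in the Weil group: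
`upperInertia F 0 = inertia F`, where `upperInertia F u` is the preimage of
`I_F^u = absUpperInertia F u ≤ Γ_F` under `toAbsGalois : W_F → Γ_F` and `inertia F` the preimage
of `I_F = absInertia F`.  It is the parent reduction `upperInertia_zero_of` fed with
`I_F^0 = I_F`, the case `R = 𝒪[F]`, `𝔓 = absMaximalIdeal F` of
`absUpperRamificationSubgroup_zero_eq_inertia_holds : Γ_K^0 = I_𝔓` (sibling file
`RamificationFiltrationProofs`: at every finite normal layer `E/K` of `K̄`,
`Gal(E/K)^0 = G_{⌈ψ 0⌉₊} = G_0` is the inertia group of `𝔓 ∩ E`, and inertia is compatible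
with restriction along the equivariant inclusion `integralClosure R E → absIntegers R K`).
Source: Serre defines the upper numbering `G^v = G_{ψ(v)}` of a finite Galois group and records
"`G^{-1} = G`, `G^0 = G_0`" (Ch. IV §3, p. 74, before Prop. 14), `G_0` being the inertia group
(Ch. IV §1, Prop. 1, p. 62: "`G_0` is the inertia subgroup of `G`"); for an infinite Galois
extension `G^v := lim← G(L'/K)^v` over the finite Galois subextensions `L'` (Ch. IV §3,
Remark 1 after Prop. 15, p. 75), which is the parent files' `absUpperRamificationSubgroup` /
`absUpperInertia`, pulled back to `W_F`.
[cite: SerreLocalFields1979, Ch. IV §3, p. 74 (before Prop. 14) and Remark 1 (p. 75)] -/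
theorem upperInertia_zero_holds : upperInertia_zero F :=
  upperInertia_zero_of F
    (absUpperRamificationSubgroup_zero_eq_inertia_holds _ (absMaximalIdeal F))

end WeilDeligneRep

/-! ### Conjugate subgroups have fixed subspaces of the same codimension -/

namespace ContinuousRep

open scoped Pointwise
open Module

variable {G : Type*} [Group G] [TopologicalSpace G] {A : Type*} [CommRing A] [TopologicalSpace A]
  {M : Type*} [AddCommGroup M] [Module A M] [TopologicalSpace M]

/-- `ρ σ` maps the fixed subspace of `H` onto the fixed subspace of the conjugate subgroup:
`M^{σHσ⁻¹} = ρ(σ) M^H`.  Ref: Serre, *Local Fields*, Ch. VI §3 (conjugate decomposition groups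
carry conjugate Artin characters); Neukirch, *Algebraic Number Theory*, Ch. I §9, after (9.5).
[folklore] -/
theorem fixedSubmodule_conj_smul (ρ : ContinuousRep G A M) (σ : G) (H : Subgroup G) :
    ρ.fixedSubmodule (MulAut.conj σ • H) = (ρ.fixedSubmodule H).map (ρ σ) := by
  ext v
  rw [mem_fixedSubmodule, Submodule.mem_map]
  constructor
  · intro hv
    refine ⟨ρ σ⁻¹ v, (ρ.mem_fixedSubmodule H _).mpr fun h hh => ?_, ?_⟩
    · have := hv (σ * h * σ⁻¹) (by
        rw [Subgroup.mem_pointwise_smul_iff_inv_smul_mem, MulAut.smul_def, MulAut.conj_inv_apply]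
        simpa [mul_assoc] using hh)
      rw [map_mul, map_mul, Module.End.mul_apply, Module.End.mul_apply] at this
      have h2 := congrArg (ρ σ⁻¹) this
      rwa [← Module.End.mul_apply, ← map_mul, inv_mul_cancel, map_one, Module.End.one_apply] at h2
    · rw [← Module.End.mul_apply, ← map_mul, mul_inv_cancel, map_one, Module.End.one_apply]
  · rintro ⟨w, hw, rfl⟩ g hg
    rw [Subgroup.mem_pointwise_smul_iff_inv_smul_mem, MulAut.smul_def, MulAut.conj_inv_apply] at hg
    have := (ρ.mem_fixedSubmodule H w).mp hw _ hg
    rw [map_mul, map_mul, Module.End.mul_apply, Module.End.mul_apply] at this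
    have h2 := congrArg (ρ σ) this
    rwa [← Module.End.mul_apply, ← Module.End.mul_apply, ← map_mul, ← map_mul,
      mul_inv_cancel, one_mul] at h2

/-- Conjugate subgroups have fixed subspaces of the same codimension:
`codim M^{σHσ⁻¹} = codim M^H` (`ρ σ` induces `M ⧸ M^H ≃ₗ[A] M ⧸ M^{σHσ⁻¹}`).
Ref: Serre, *Local Fields*, Ch. VI §3 (independence of `a_𝔭` from `𝔓 ∣ 𝔭`); Neukirch,
*Algebraic Number Theory*, Ch. I §9, after (9.5). [folklore] -/
theorem codimFixed_conj_smul (ρ : ContinuousRep G A M) (σ : G) (H : Subgroup G) :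
    ρ.codimFixed (MulAut.conj σ • H) = ρ.codimFixed H := by
  rw [codimFixed, codimFixed]
  exact (LinearEquiv.finrank_eq (Submodule.Quotient.equiv (ρ.fixedSubmodule H)
    (ρ.fixedSubmodule (MulAut.conj σ • H))
    (LinearMap.GeneralLinearGroup.toLinearEquiv (ρ.toRepresentation.asGroupHom σ))
    (ρ.fixedSubmodule_conj_smul σ H).symm)).symm

end ContinuousRep

/-! ### Conjugate primes have the same Swan and Artin conductors -/

namespace GaloisRep

section Conj

open scoped Pointwise
open MeasureTheory

variable {K : Type*} [Field K] {A : Type*} [CommRing A] [TopologicalSpace A]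
  {M : Type*} [AddCommGroup M] [Module A M] [TopologicalSpace M]
  {R : Type*} [CommRing R] [Algebra R K]

/-- `sw_{σ𝔓}(ρ) = sw_𝔓(ρ)`: the Swan conductor at a conjugate prime is the same (the integrands
agree pointwise, by `absUpperRamificationSubgroup_smul` and `codimFixed_conj_smul`).
Ref: Serre, *Local Fields*, Ch. VI §3 (globalisation); Neukirch, *Algebraic Number Theory*,
Ch. I §9, after (9.5). [cite: SerreLocalFields1979, Ch. VI §3] -/
theorem swanConductorAt_smul (σ : absoluteGaloisGroup K) (𝔓 : Ideal (absIntegers R K))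
    (ρ : GaloisRep K A M) : ρ.swanConductorAt R (σ • 𝔓) = ρ.swanConductorAt R 𝔓 := by
  simp only [swanConductorAt_def, absUpperRamificationSubgroup_smul,
    ContinuousRep.codimFixed_conj_smul]

/-- `a_{σ𝔓}(ρ) = a_𝔓(ρ)`: the Artin conductor at a conjugate prime is the same
(`I_{σ𝔓} = σ I_𝔓 σ⁻¹`, `codimFixed_conj_smul`, `swanConductorAt_smul`).
Ref: Serre, *Local Fields*, Ch. VI §3 (globalisation: `a_𝔭 = (a_𝔓)^*` for any `𝔓 ∣ 𝔭`);
Neukirch, *Algebraic Number Theory*, Ch. I §9, after (9.5).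
[cite: SerreLocalFields1979, Ch. VI §3] -/
theorem artinConductorAt_smul (σ : absoluteGaloisGroup K) (𝔓 : Ideal (absIntegers R K))
    (ρ : GaloisRep K A M) : ρ.artinConductorAt R (σ • 𝔓) = ρ.artinConductorAt R 𝔓 := by
  rw [artinConductorAt_def, artinConductorAt_def, swanConductorAt_smul, absIntegers.inertia_smul,
    ContinuousRep.codimFixed_conj_smul]

/-- **Discharge of `Literature.NumberTheory.GaloisRepresentations.GaloisRep.artinConductorAt_eq_of_mem_primesAbove`** (independence of
the prime above `v`).  For a number field `K` and `𝔓, 𝔓' ∣ v`, some `σ ∈ Γ_K` carries `𝔓` to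
`𝔓'` (`HeightOneSpectrum.exists_smul_eq_of_mem_primesAbove_holds`), and
`a_{σ𝔓}(ρ) = a_𝔓(ρ)` (`artinConductorAt_smul`).
Ref: Serre, *Local Fields*, Ch. VI §3 (globalisation, independence of the choice of `𝔓 ∣ 𝔭`);
Neukirch, *Algebraic Number Theory*, Ch. I §9, Prop. (9.1) and the remark after (9.5).
[cite: SerreLocalFields1979, Ch. VI §3] -/
theorem artinConductorAt_eq_of_mem_primesAbove_holds :
    artinConductorAt_eq_of_mem_primesAbove (K := K) (A := A) (M := M) := by
  intro _ v 𝔓 𝔓' h𝔓 h𝔓' ρ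
  obtain ⟨σ, rfl⟩ := HeightOneSpectrum.exists_smul_eq_of_mem_primesAbove_holds h𝔓 h𝔓'
  exact (ρ.artinConductorAt_smul σ 𝔓).symm

end Conj

/-! ### Reduction of the specification of the conductor exponent to Artin–Katz integrality -/

section Integrality

universe u v w

variable {K : Type u} [Field K] [NumberField K]

/-- **The finite-quotient specification of `artinConductorExponent` from integrality alone.**
Given Artin–Katz integrality in its finite-quotient form
`exists_natCast_eq_artinConductorAt_of_hasOpenInertiaKerAt` (`a_𝔓(ρ) ∈ ℕ` for a
finite-dimensional `ρ` over a field `A` of characteristic `≠ p` whose restriction to `I_𝔓` factors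
through a finite discrete quotient; Katz, Prop. 1.9, Serre, Ch. VI §2 Thm 1'), the specification
`artinConductorExponent v ρ = ⌊a_{𝔓₀}(ρ)⌋₊ = a_𝔓(ρ)` holds at every `𝔓 ∣ v`: by the discharged
independence of the prime (`artinConductorAt_eq_of_mem_primesAbove_holds`),
`a_{𝔓₀}(ρ) = a_𝔓(ρ) = n ∈ ℕ` and `⌊n⌋₊ = n` (the parent reduction
`natCast_artinConductorExponent_of_hasOpenInertiaKerAt_of` with its first hypothesis fed).  The
integrality hypothesis stays threaded (D-0014) because it rests on Herbrand's theorem and the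
Hasse–Arf/Brauer/Swan-representation theory, none of which is in Mathlib; it is reduced to those
two inputs in `natCast_artinConductorExponent_of_hasOpenInertiaKerAt_of_herbrand` below.  (This
theorem replaces the former `natCast_artinConductorExponent_of`, which derived the over-general
`natCast_artinConductorExponent` from the over-general `exists_natCast_eq_artinConductorAt`; both
parent defs let the topologies on `A` and `M` be arbitrary — covering discontinuous
representations, which no source treats — and the latter moreover failed to quantify
`[FiniteDimensional A M]`, so they were retired on 2026-08-15 after the provefact audits; see the
faithfulness note of the parent file.)
Ref: Katz, *Gauss Sums, Kloosterman Sums, and Monodromy Groups* (1988), Ch. 1, Prop. 1.9 and its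
proof; Serre, *Local Fields*, Ch. VI §2, Thm 1' and §3.
[cite: Katz1988, Ch. 1, Prop. 1.9 (and its proof)] -/
theorem natCast_artinConductorExponent_of_hasOpenInertiaKerAt_of_integrality
    (h : ∀ {A : Type v} [Field A] [TopologicalSpace A] {M : Type w} [AddCommGroup M] [Module A M]
      [TopologicalSpace M],
      exists_natCast_eq_artinConductorAt_of_hasOpenInertiaKerAt (K := K) (A := A) (M := M)) :
    natCast_artinConductorExponent_of_hasOpenInertiaKerAt.{u, v, w} (K := K) :=
  natCast_artinConductorExponent_of_hasOpenInertiaKerAt_of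
    (fun {_} _ _ {_} _ _ _ => artinConductorAt_eq_of_mem_primesAbove_holds) h

end Integrality

/-! ### The corrected specification of the conductor exponent from the printed theorems -/

section NumberFieldFiniteQuotientAssembly

universe u v w

variable {K : Type u} [Field K] [NumberField K]

/-- **`natCast_artinConductorExponent_of_hasOpenInertiaKerAt` from Herbrand's theorem and Artin's
theorem.**  The corrected specification of the conductor exponent — `(a_v(ρ) : ℝ) = a_𝔓(ρ)` for
every prime `𝔓 ∣ v`, every finite-dimensional `ρ` over a field `A` with `char A ≠ p` whose
restriction to `I_𝔓` factors through a finite discrete quotient — follows from the discharged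
independence of the prime (`artinConductorAt_eq_of_mem_primesAbove_holds`) and the finite-quotient
integrality `exists_natCast_eq_artinConductorAt_of_hasOpenInertiaKerAt`, which
`ArtinConductorIntegralityProofs.lean` reduces
(`exists_natCast_eq_artinConductorAt_of_hasOpenInertiaKerAt_of_herbrand`) to Herbrand's theorem
for `K̄/E/K` (the named fact `absUpperRamificationSubgroup_map_absRestrictNormalHom`, hypothesis
`hH`) and Artin's theorem `f(τ) ∈ ℕ` for representations of the inertia group (the named fact
`exists_natCast_eq_artinExponent`, hypothesis `hint`), following Katz's proof of Prop. 1.9.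
Ref: Katz, *Gauss sums, Kloosterman sums, and monodromy groups* (1988), Ch. 1, Prop. 1.9 and its
proof; Serre, *Local Fields*, Ch. VI §2, Thm 1' and Cor. 1', and §3.
[cite: Katz1988, Ch. 1, Prop. 1.9 (and its proof)] -/
theorem natCast_artinConductorExponent_of_hasOpenInertiaKerAt_of_herbrand
    (hH : absUpperRamificationSubgroup_map_absRestrictNormalHom (K := K))
    (hint : ∀ {A : Type v} [Field A] [TopologicalSpace A] {M : Type w} [AddCommGroup M]
      [Module A M] [TopologicalSpace M], exists_natCast_eq_artinExponent (K := K) (A := A) (M := M)) :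
    natCast_artinConductorExponent_of_hasOpenInertiaKerAt.{u, v, w} (K := K) :=
  natCast_artinConductorExponent_of_hasOpenInertiaKerAt_of
    (fun {_} _ _ {_} _ _ _ => artinConductorAt_eq_of_mem_primesAbove_holds)
    (@fun A _ _ M _ _ _ =>
      exists_natCast_eq_artinConductorAt_of_hasOpenInertiaKerAt_of_herbrand (A := A) (M := M) hH hint)

/-- **`natCast_artinConductorExponent_of_hasOpenInertiaKerAt` from `herbrand_quotient` and Artin's
theorem**: as `natCast_artinConductorExponent_of_hasOpenInertiaKerAt_of_herbrand`, with Herbrand's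
theorem for `K̄/E/K` replaced by the finite-level named fact `herbrand_quotient` of
`RamificationFiltration.lean` for all layers `E ≤ E'` of `K̄`
(`absUpperRamificationSubgroup_map_absRestrictNormalHom_of` of `ArtinConductorIntegralityProofs`).
So the corrected specification of the conductor exponent rests on exactly
two printed theorems absent from Mathlib: Herbrand's `(G/H)^v = G^v H/H` (Serre, Ch. IV §3,
Prop. 14) and Artin's theorem (Serre, Ch. VI §2, Thm 1'; *Linear Representations* §19.3 in
characteristic `ℓ`).
Ref: Katz (1988), Ch. 1, Prop. 1.9 and its proof; Serre, *Local Fields*, Ch. IV §3 Prop. 14,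
Ch. VI §2 Thm 1' and §3. [cite: Katz1988, Ch. 1, Prop. 1.9 (and its proof)] -/
theorem natCast_artinConductorExponent_of_hasOpenInertiaKerAt_of_herbrand_quotient
    (hq : ∀ (R : Type u) [CommRing R] [Algebra R K] {E E' : IntermediateField K (AlgebraicClosure K)}
      (hle : E ≤ E'), herbrand_quotient R (IntermediateField.restrict hle))
    (hint : ∀ {A : Type v} [Field A] [TopologicalSpace A] {M : Type w} [AddCommGroup M]
      [Module A M] [TopologicalSpace M], exists_natCast_eq_artinExponent (K := K) (A := A) (M := M)) :
    natCast_artinConductorExponent_of_hasOpenInertiaKerAt.{u, v, w} (K := K) :=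
  natCast_artinConductorExponent_of_hasOpenInertiaKerAt_of_herbrand
    (absUpperRamificationSubgroup_map_absRestrictNormalHom_of hq) hint

end NumberFieldFiniteQuotientAssembly

/-! ### Vanishing of the Artin conductor characterises the unramified places -/

section UnramifiedIff

universe u v w

variable {K : Type u} [Field K] {A : Type v} [Field A] [TopologicalSpace A]
  {M : Type w} [AddCommGroup M] [Module A M] [TopologicalSpace M] [FiniteDimensional A M]

/-- **Discharge of `Literature.NumberTheory.GaloisRepresentations.GaloisRep.artinConductorAt_eq_zero_iff_isUnramifiedAt`.**  For a number
field `K`, a finite place `v`, a prime `𝔓 ∣ v` of `\bar ℤ_K` and a finite-dimensional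
representation `ρ` over a field `A`, `a_𝔓(ρ) = 0 ↔ ρ` is unramified at `v`.  The parent
reduction `artinConductorAt_eq_zero_iff_isUnramifiedAt_of` is fed with the two discharged facts it
threads: `IsUnramifiedAtPrime.artinConductorAt_eq_zero_holds` (this file: `I_𝔓` acts trivially ⇒
`a_𝔓(ρ) = 0`, via `Γ_K^u ≤ I_𝔓`) and `isUnramifiedAt_of_isUnramifiedAtPrime_holds`
(`GaloisRepFrobeniusProofs`: unramified at one `𝔓 ∣ v` ⇒ unramified at `v`, the primes above `v`
being `Γ_K`-conjugate); the direction `a_𝔓(ρ) = 0 ⇒ I_𝔓` acts trivially is `0 ≤ sw_𝔓(ρ)` and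
`codim M^{I_𝔓} = 0 ↔ M^{I_𝔓} = M` (finite-dimensional `M` over a field), proved in the parent
file.
Source: Serre, *Local Fields*, Ch. VI §2, Cor. 1' to Prop. 2 — for the character `χ` of a
representation of `G = Gal(L/K)` in `V`, `f(χ) = Σ_i (g_i/g_0) codim V^{G_i}` with
`codim V^{G_i} = dim V - dim V^{G_i}`: a sum of non-negative terms whose `i = 0` term is
`codim V^{G_0}`, and `V^{G_0} ⊆ V^{G_i}`, so `f(χ) = 0` iff the inertia group `G_0` acts
trivially on `V` — and Ch. VI §3 ("Clearly `f(χ, 𝔭) = 0` when `𝔭` is unramified").  Thm 1' itself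
is the integrality `f(χ) ∈ ℕ`; the parent docstring's locator "Thm 1' (2)" designates this
consequence of Cor. 1', and the vendored statement is the one printed there (no discrepancy).
[cite: SerreLocalFields1979, Ch. VI §2, Cor. 1' to Prop. 2, and §3] -/
theorem artinConductorAt_eq_zero_iff_isUnramifiedAt_holds :
    artinConductorAt_eq_zero_iff_isUnramifiedAt (K := K) (A := A) (M := M) :=
  artinConductorAt_eq_zero_iff_isUnramifiedAt_of
    (fun {_} _ _ {_} _ _ _ => IsUnramifiedAtPrime.artinConductorAt_eq_zero_holds)
    isUnramifiedAt_of_isUnramifiedAtPrime_holds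

end UnramifiedIff

/-! ### Finite wild image on a Hausdorff module: `P` acts through a finite discrete quotient -/

section WildKernel

universe u v w

variable {K : Type u} [Field K] {A : Type v} [CommRing A] [TopologicalSpace A]
  {M : Type w} [AddCommGroup M] [Module A M] [TopologicalSpace M]
  {R : Type*} [CommRing R] [Algebra R K]

/-- **Finite wild image on a Hausdorff module is Katz's standing hypothesis.**  If `M` is
Hausdorff and `ρ` takes finitely many values on `⋃_{u>0} Γ_K^u` (`HasFiniteWildImageAt`), then
`ρ` is trivial on `Gal(K̄/E) ∩ \overline{⋃_{u>0} Γ_K^u}` for some finite normal `E/K ⊆ K̄`, i.e.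
the restriction of `ρ` to the wild inertia group `P_𝔓` (the closure of `⋃_{u>0} Γ_K^u`) factors
through a finite *discrete* quotient — "the action of `P` factors through a finite discrete
quotient of `P`", the hypothesis of Katz 1.1–1.8 under which the break decomposition and the Swan
conductor are studied.  (Fibres of `ρ` are cosets of the closed kernel, `ContinuousRep.isClosed_ker`;
the closure of `⋃_{u>0} Γ_K^u` lies in the finite union of the fibres met; the complement of the
non-trivial fibres is a neighbourhood of `1`, hence contains `Gal(K̄/E)` for a finite normal `E`,
`krullTopology_mem_nhds_one_iff_of_normal`.)  For the indiscrete topology on `M` the conclusion can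
fail, which is the gap between the retired over-general `natCast_artinConductorExponent` (any
topology on `M`) and the sources (faithfulness note of the parent file).
Ref: Katz, *Gauss sums, Kloosterman sums, and monodromy groups* (1988), Ch. 1, 1.1 and Lemma 1.8
("such that the action of `P` factors through a finite discrete quotient of `P`").
[cite: Katz1988, Ch. 1, 1.1 and Lemma 1.8] -/
theorem HasFiniteWildImageAt.exists_normal_forall_apply_eq_one [T2Space M]
    {𝔓 : Ideal (absIntegers R K)} {ρ : GaloisRep K A M} (h : ρ.HasFiniteWildImageAt R 𝔓) :
    ∃ E : IntermediateField K (AlgebraicClosure K), FiniteDimensional K E ∧ Normal K E ∧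
      ∀ σ ∈ closure {σ : absoluteGaloisGroup K |
          ∃ u : ℝ, 0 < u ∧ σ ∈ absUpperRamificationSubgroup R 𝔓 u},
        absoluteGaloisGroup.toAlgEquiv K σ ∈ E.fixingSubgroup → ρ σ = 1 := by
  classical
  set S : Set (absoluteGaloisGroup K) :=
    {σ | ∃ u : ℝ, 0 < u ∧ σ ∈ absUpperRamificationSubgroup R 𝔓 u} with hS
  -- the fibres of `ρ` are closed: `{σ | ρ σ = ρ σ₀} = σ₀ • ker ρ`
  have hfib : ∀ σ₀ : absoluteGaloisGroup K,
      IsClosed {σ : absoluteGaloisGroup K | ρ σ = ρ σ₀} := by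
    intro σ₀
    have hset : {σ : absoluteGaloisGroup K | ρ σ = ρ σ₀} =
        (fun σ => σ₀⁻¹ * σ) ⁻¹' (ρ.ker : Set (absoluteGaloisGroup K)) := by
      ext σ
      simp only [Set.mem_setOf_eq, Set.mem_preimage, SetLike.mem_coe, ContinuousRep.mem_ker]
      constructor
      · intro hσ
        rw [map_mul, hσ, ← map_mul, inv_mul_cancel, map_one, Module.End.one_eq_id]
      · intro hσ
        have : ρ σ = ρ (σ₀ * (σ₀⁻¹ * σ)) := by rw [mul_inv_cancel_left]
        rw [this, map_mul, hσ, ← Module.End.one_eq_id, mul_one]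
    rw [hset]
    exact ρ.isClosed_ker.preimage (continuous_const_mul _)
  -- the closure of `S` lies in the (finite, closed) union of the fibres over `ρ '' S`
  have hCl : IsClosed (⋃ g ∈ ρ '' S, {σ : absoluteGaloisGroup K | ρ σ = g}) := by
    refine h.isClosed_biUnion fun g hg => ?_
    obtain ⟨σ₀, -, rfl⟩ := hg
    exact hfib σ₀
  have hsub : closure S ⊆ ⋃ g ∈ ρ '' S, {σ : absoluteGaloisGroup K | ρ σ = g} :=
    closure_minimal (fun σ hσ => Set.mem_iUnion₂.mpr ⟨ρ σ, ⟨σ, hσ, rfl⟩, rfl⟩) hCl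
  -- the bad set: elements of the closure with non-trivial image
  set T : Set (absoluteGaloisGroup K) :=
    closure S ∩ ⋃ g ∈ (ρ '' S) \ {1}, {σ : absoluteGaloisGroup K | ρ σ = g} with hT
  have hTc : IsClosed T := by
    refine isClosed_closure.inter ((h.subset Set.sdiff_subset).isClosed_biUnion fun g hg => ?_)
    obtain ⟨σ₀, -, rfl⟩ := hg.1
    exact hfib σ₀
  have h1T : (1 : absoluteGaloisGroup K) ∉ T := by
    rintro ⟨-, h1⟩
    obtain ⟨g, hg, hg1⟩ := Set.mem_iUnion₂.mp h1
    exact hg.2 (by rw [← (hg1 : ρ 1 = g), map_one]; rfl)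
  have hnhds : Tᶜ ∈ nhds (1 : absoluteGaloisGroup K) := hTc.isOpen_compl.mem_nhds h1T
  obtain ⟨E, hEfd, hEn, hE⟩ :=
    (krullTopology_mem_nhds_one_iff_of_normal K (AlgebraicClosure K) _).mp hnhds
  refine ⟨E, hEfd, hEn, fun σ hσ hσE => ?_⟩
  have hσT : σ ∉ T := hE hσE
  obtain ⟨g, hg, hσg⟩ := Set.mem_iUnion₂.mp (hsub hσ)
  by_contra hne
  exact hσT ⟨hσ, Set.mem_iUnion₂.mpr ⟨g, ⟨hg, fun hg1 => hne (hσg.trans hg1)⟩, hσg⟩⟩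

end WildKernel

/-! ### The `ℓ`-adic specification of the conductor exponent from Katz 1.9–1.10 -/

section NumberFieldLAdicAssembly

universe u v w

variable {K : Type u} [Field K] [NumberField K]

/-- **`natCast_artinConductorExponent_lAdic` from Katz's `ℓ`-adic integrality alone.**  The
independence of the prime being discharged (`artinConductorAt_eq_of_mem_primesAbove_holds`), the
`ℓ`-adic specification of the conductor exponent — `(a_v(ρ) : ℝ) = a_𝔓(ρ)` for every continuous
representation on a finite-dimensional vector space over a finite extension of `ℚ_ℓ` with its
module topology and every `𝔓 ∣ v ∤ ℓ` — rests exactly on the named fact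
`exists_natCast_eq_artinConductorAt_lAdic` of `ArtinConductorIntegrality.lean` (Katz, Prop. 1.9
with Remark 1.10: `Swan(M) = Swan(𝐌 ⊗ 𝔽_λ) ∈ ℤ_{≥0}` for an `I`-stable `𝒪_λ`-lattice `𝐌`).
Ref: Katz, *Gauss sums, Kloosterman sums, and monodromy groups* (1988), Ch. 1, Prop. 1.9 and
Remark 1.10 (pp. 18–19); Serre, *Local Fields*, Ch. VI §3.
[cite: Katz1988, Ch. 1, Prop. 1.9 and Remark 1.10] -/
theorem natCast_artinConductorExponent_lAdic_of_lAdic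
    (h : exists_natCast_eq_artinConductorAt_lAdic.{u, v, w} (K := K)) :
    natCast_artinConductorExponent_lAdic.{u, v, w} (K := K) :=
  natCast_artinConductorExponent_lAdic_of
    (fun {_} _ _ {_} _ _ _ => artinConductorAt_eq_of_mem_primesAbove_holds)
    (fun h𝔓 ρ hℓ => h h𝔓 ρ hℓ)

end NumberFieldLAdicAssembly

end GaloisRep

end Literature.NumberTheory.GaloisRepresentations
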